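import Summits.QuantumFields.YangMills.Theorems.LuscherReductionTwistedTraceScalingBOStiffPiDensityCentral
import Summits.QuantumFields.YangMills.Theorems.LuscherReductionTwistedTraceScalingBOStiffDoor
import HarnessLib

/-!
# (B-ST) atom (B3) «PiDensity», the glue to `spec_gap_inputs`: POINCARÉ INEQUALITIES WITH DOOR DATA `(D, J₀)` TRANSPORT FROM A FLAT MEASURE `ν` TO `π` UNDER A TWO-SIDED
# COMPARISON `c·ν ≤ π ≤ C·ν` ON THE SUPPORT — `hflat(ν; P₀, δ) ⇒ hflat(π; (C/c²)·P₀, (C/c)·δ)`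
# (lane A of S-BASE, crux `TwistedTraceScaling` stmt-QuantumFields-20203, C4-CORE, the (B-ST) pen, hand B; `pub/ym-fleet/ym-luscher-20007-p1/HANDOFF-g21.md` §START HERE:
# «PiDensity to pass Lebesgue ↔ π (Var is monotone in the measure; jump form within c^{-2})»)

The `hflat` clause of the fibre-gap door (`…BOStiffFibreGapDoor.hgap_of_door`, spec `spec_gap_inputs`) is a Poincaré inequality for the flat door data `(D, J₀)` against the
TRANSVERSE measure `π = orthoTransverse L` on the profile support `cS L β`; hand C proves it against LEBESGUE measure of the flat coordinates (Mehler ⊗ gauge Gaussian, killed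
transfer, tensorisation).  THIS FILE is the measure-change step, abstractly and at the central fibre:
* §1 (any measurable space, `π` finite, any `ν`, measurable `S`, `ofReal c • ν|_S ≤ π|_S ≤ ofReal C • ν|_S`): `restrict_isFiniteMeasure_of_comparison`, the one-measure-to-the-other
  monotonicity of set integrals of non-negative bounded functions (`setIntegral_le_of_comparison`, `setIntegral_ge_of_comparison`), of the jump form supported in `S × S`
  (`jumpForm_le_of_comparison`: `∫_S∫_S F dν dν ≤ c⁻²·∫∫ F dπ dπ`), the variational characterisation of the variance allowing a degenerate weight (`sq_dev_eq_variance`,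
  `variance_le_sq_dev'`), and ★★★ `poincare_transport`:
  `∫_S g²D dν − (∫_S gD dν)²/∫_S D dν ≤ P₀·½∫_S∫_S (g x − g y)²J₀ dν dν + δ∫_S g²D dν`  ⇒  `∫_S g²D dπ − (∫_S gD dπ)²/∫_S D dπ ≤ (C/c²)P₀·½∫∫(g x − g y)²J₀ dπ dπ + (C/c)δ∫_S g²D dπ`
  for bounded measurable `g`, `D ≥ 0` bounded measurable, `J₀ ≥ 0` bounded jointly measurable vanishing off `S × S` (`S` need not be measurable, `g` need not vanish off `S`);
* §2 ★★★ `hflat_transport_cS` — at the central fibre with `ν = balLebesgue L`, `S = cS L β`: by `…BOStiffPiDensityCentral.orthoTransverse_restrict_cS_sharp` there is `ρ₀ > 0` with, for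
  every `ε ∈ (0,1)` and all large `β`, `hflat(balLebesgue; P₀, δ) ⇒ hflat(orthoTransverse; ((1+ε)/((1−ε)²ρ₀))·P₀, ((1+ε)/(1−ε))·δ)` — `β`-FREE factors, as `spec_gap_inputs` requires.
HONEST FRAMING: measure bookkeeping for a stub of a child of the CONDITIONAL route R2b1; the flat Poincaré inequality itself ((B1)(B2), hand C) and (B4) are NOT touched; (B-ST) OPEN;
C4-CORE OPEN; not infinite volume, not a gap, not Clay.  No named facts, no `sorry`.
-/

set_option autoImplicit false

noncomputable section

open MeasureTheory Filter Topology Real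
open scoped BigOperators ENNReal

namespace Summit.QuantumFields.YangMills.Theorems.FemtoTransferGap.StiffDoor

/-! ## §1 Abstract transport under a two-sided comparison on the support -/

section Transport

variable {X : Type*} [MeasurableSpace X] {μ ν : Measure X} [IsFiniteMeasure μ] {S : Set X} {c C : ℝ}

/-- Under `ofReal c • ν|_S ≤ μ|_S` with `c > 0` and `μ` finite, `ν|_S` is finite. [folklore] -/
theorem restrict_isFiniteMeasure_of_comparison (hc : 0 < c) (hlo : ENNReal.ofReal c • ν.restrict S ≤ μ.restrict S) : IsFiniteMeasure (ν.restrict S) := by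
  refine ⟨?_⟩
  have h := hlo Set.univ
  rw [Measure.smul_apply, smul_eq_mul] at h
  have hμ : μ.restrict S Set.univ < ⊤ := measure_lt_top _ _
  have hc' : ENNReal.ofReal c ≠ 0 := (ENNReal.ofReal_pos.2 hc).ne'
  by_contra htop
  rw [not_lt, top_le_iff] at htop
  rw [htop, ENNReal.mul_top hc'] at h
  exact (lt_irrefl _) (hμ.trans_le h)

/-- Upper transport of a set integral of a non-negative bounded measurable function: `∫_S f dμ ≤ C·∫_S f dν`. [folklore] -/
theorem setIntegral_le_of_comparison (hc : 0 < c) (hC : 0 ≤ C) (hlo : ENNReal.ofReal c • ν.restrict S ≤ μ.restrict S) (hup : μ.restrict S ≤ ENNReal.ofReal C • ν.restrict S)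
    {f : X → ℝ} (hf : Measurable f) (hf0 : ∀ x, 0 ≤ f x) {Cf : ℝ} (hfb : ∀ x, f x ≤ Cf) :
    ∫ x in S, f x ∂μ ≤ C * ∫ x in S, f x ∂ν := by
  haveI := restrict_isFiniteMeasure_of_comparison hc hlo
  have hbdd : ∀ x, ‖f x‖ ≤ max Cf 0 := fun x => by rw [Real.norm_eq_abs, abs_of_nonneg (hf0 x)]; exact (hfb x).trans (le_max_left _ _)
  have hint : Integrable f (ν.restrict S) := Integrable.of_bound hf.aestronglyMeasurable (max Cf 0) (ae_of_all _ hbdd)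
  have h := integral_mono_measure hup (ae_of_all _ hf0) (hint.smul_measure ENNReal.ofReal_ne_top)
  rwa [integral_smul_measure, ENNReal.toReal_ofReal hC, smul_eq_mul] at h

/-- Lower transport: `c·∫_S f dν ≤ ∫_S f dμ`. [folklore] -/
theorem setIntegral_ge_of_comparison (hc : 0 < c) (hlo : ENNReal.ofReal c • ν.restrict S ≤ μ.restrict S)
    {f : X → ℝ} (hf : Measurable f) (hf0 : ∀ x, 0 ≤ f x) {Cf : ℝ} (hfb : ∀ x, f x ≤ Cf) :
    c * ∫ x in S, f x ∂ν ≤ ∫ x in S, f x ∂μ := by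
  have hbdd : ∀ x, ‖f x‖ ≤ max Cf 0 := fun x => by rw [Real.norm_eq_abs, abs_of_nonneg (hf0 x)]; exact (hfb x).trans (le_max_left _ _)
  have hint : Integrable f (μ.restrict S) := Integrable.of_bound hf.aestronglyMeasurable (max Cf 0) (ae_of_all _ hbdd)
  have h := integral_mono_measure hlo (ae_of_all _ hf0) hint
  rwa [integral_smul_measure, ENNReal.toReal_ofReal hc.le, smul_eq_mul] at h

omit [IsFiniteMeasure μ] in
/-- A jump form whose kernel vanishes off `S × S` may be written with or without the restriction to `S` (any measure). [folklore] -/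
theorem jumpForm_restrict_eq {F : X → X → ℝ} (hFS : ∀ x y, F x y ≠ 0 → x ∈ S ∧ y ∈ S) :
    ∫ x in S, ∫ y in S, F x y ∂μ ∂μ = ∫ x, ∫ y, F x y ∂μ ∂μ := by
  have hin : ∀ x, ∫ y in S, F x y ∂μ = ∫ y, F x y ∂μ := fun x =>
    setIntegral_eq_integral_of_forall_compl_eq_zero fun y hy => by by_contra h; exact hy (hFS x y h).2
  rw [setIntegral_eq_integral_of_forall_compl_eq_zero fun x hx => ?_]
  · exact integral_congr_ae (ae_of_all _ hin)
  · rw [hin]; exact integral_eq_zero_of_ae (ae_of_all _ fun y => by by_contra h; exact hx (hFS x y h).1)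

/-- ★ **Jump forms supported in `S × S` transport with `c⁻²`**: for `F ≥ 0` bounded jointly measurable with `F x y = 0` unless `x, y ∈ S`,
`∫_S ∫_S F dν dν ≤ c⁻²·∫∫ F dμ dμ`. [folklore] -/
theorem jumpForm_le_of_comparison (hc : 0 < c) (hlo : ENNReal.ofReal c • ν.restrict S ≤ μ.restrict S)
    {F : X → X → ℝ} (hF : Measurable (Function.uncurry F)) (hF0 : ∀ x y, 0 ≤ F x y) {CF : ℝ} (hFb : ∀ x y, F x y ≤ CF) (hFS : ∀ x y, F x y ≠ 0 → x ∈ S ∧ y ∈ S) :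
    ∫ x in S, ∫ y in S, F x y ∂ν ∂ν ≤ (1 / c ^ 2) * ∫ x, ∫ y, F x y ∂μ ∂μ := by
  haveI := restrict_isFiniteMeasure_of_comparison hc hlo
  have hCF : 0 ≤ max CF 0 := le_max_right _ _
  have habs : ∀ x y, |F x y| ≤ max CF 0 := fun x y => by rw [abs_of_nonneg (hF0 x y)]; exact (hFb x y).trans (le_max_left _ _)
  -- inner transport, pointwise in `x`
  have hin : ∀ x, ∫ y in S, F x y ∂ν ≤ (1 / c) * ∫ y, F x y ∂μ := fun x => by
    have hmx : Measurable fun y => F x y := hF.comp (measurable_const.prodMk measurable_id)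
    have h1 := setIntegral_ge_of_comparison (S := S) hc hlo hmx (hF0 x) (fun y => hFb x y)
    have h2 : ∫ y in S, F x y ∂μ = ∫ y, F x y ∂μ :=
      setIntegral_eq_integral_of_forall_compl_eq_zero fun y hy => by
        by_contra h; exact hy (hFS x y h).2
    rw [h2] at h1
    rw [one_div, ← div_eq_inv_mul]
    exact (le_div_iff₀' hc).mpr h1
  -- the outer integrands are bounded measurable; the `μ`-one vanishes off `S`
  obtain ⟨hmμ, hbμ⟩ := measurable_integral_right_of_bdd (μ := μ) hF habs
  have hmν : Measurable fun x => ∫ y in S, F x y ∂ν := (hF.stronglyMeasurable.integral_prod_right' (ν := ν.restrict S)).measurable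
  have hbν : ∀ x, |∫ y in S, F x y ∂ν| ≤ max CF 0 * (ν.restrict S).real Set.univ := fun x => by
    have h := norm_integral_le_of_norm_le_const (μ := ν.restrict S) (f := fun y => F x y) (C := max CF 0) (Filter.Eventually.of_forall fun y => by
      rw [Real.norm_eq_abs]; exact habs x y)
    rw [Real.norm_eq_abs] at h
    linarith [mul_comm (max CF 0) ((ν.restrict S).real Set.univ)]
  have h0μ : ∀ x, 0 ≤ ∫ y, F x y ∂μ := fun x => integral_nonneg fun y => hF0 x y
  have hSμ : ∫ x in S, (fun x => ∫ y, F x y ∂μ) x ∂μ = ∫ x, ∫ y, F x y ∂μ ∂μ :=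
    setIntegral_eq_integral_of_forall_compl_eq_zero fun x hx => by
      refine integral_eq_zero_of_ae (ae_of_all _ fun y => ?_)
      by_contra h; exact hx (hFS x y h).1
  -- outer transport
  have hstep1 : ∫ x in S, ∫ y in S, F x y ∂ν ∂ν ≤ ∫ x in S, (1 / c) * ∫ y, F x y ∂μ ∂ν := by
    refine integral_mono_of_nonneg (ae_of_all _ fun x => integral_nonneg fun y => hF0 x y) ?_ (ae_of_all _ hin)
    exact (Integrable.of_bound hmμ.aestronglyMeasurable (max CF 0 * μ.real Set.univ) (ae_of_all _ fun x => by
      rw [Real.norm_eq_abs]; exact hbμ x)).const_mul _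
  have hstep2 : ∫ x in S, (1 / c) * ∫ y, F x y ∂μ ∂ν = (1 / c) * ∫ x in S, ∫ y, F x y ∂μ ∂ν := integral_const_mul _ _
  have hstep3 : c * ∫ x in S, ∫ y, F x y ∂μ ∂ν ≤ ∫ x in S, ∫ y, F x y ∂μ ∂μ :=
    setIntegral_ge_of_comparison (S := S) hc hlo hmμ h0μ (Cf := max CF 0 * μ.real Set.univ) fun x => (le_abs_self _).trans (hbμ x)
  have hstep3' : ∫ x in S, ∫ y, F x y ∂μ ∂ν ≤ (1 / c) * ∫ x, ∫ y, F x y ∂μ ∂μ := by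
    rw [hSμ] at hstep3
    rw [one_div, ← div_eq_inv_mul]
    exact (le_div_iff₀' hc).mpr hstep3
  calc ∫ x in S, ∫ y in S, F x y ∂ν ∂ν ≤ (1 / c) * ∫ x in S, ∫ y, F x y ∂μ ∂ν := hstep1.trans_eq hstep2
    _ ≤ (1 / c) * ((1 / c) * ∫ x, ∫ y, F x y ∂μ ∂μ) := mul_le_mul_of_nonneg_left hstep3' (by positivity)
    _ = (1 / c ^ 2) * ∫ x, ∫ y, F x y ∂μ ∂μ := by rw [← mul_assoc, sq, one_div_mul_one_div]

omit [IsFiniteMeasure μ] in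
/-- The mean square deviation from the mean `a = ∫_S gD/∫_S D` IS the variance `∫_S g²D − (∫_S gD)²/∫_S D` — also when `∫_S D = 0` (then `a = 0` and both sides are `∫_S g²D`, with Lean's
`x/0 = 0`); any measure `μ` for which the three integrands are integrable on `S`. [folklore] -/
theorem sq_dev_eq_variance {μ : Measure X} {g D : X → ℝ} (iN : Integrable (fun x => g x ^ 2 * D x) (μ.restrict S)) (im : Integrable (fun x => g x * D x) (μ.restrict S))
    (iZ : Integrable D (μ.restrict S)) :
    ∫ x in S, (g x - (∫ x in S, g x * D x ∂μ) / ∫ x in S, D x ∂μ) ^ 2 * D x ∂μ = (∫ x in S, g x ^ 2 * D x ∂μ) - (∫ x in S, g x * D x ∂μ) ^ 2 / ∫ x in S, D x ∂μ := by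
  set Z := ∫ x in S, D x ∂μ
  set N := ∫ x in S, g x ^ 2 * D x ∂μ
  set m := ∫ x in S, g x * D x ∂μ
  set a := m / Z with ha
  have hexp : ∫ x in S, (g x - a) ^ 2 * D x ∂μ = N - 2 * a * m + a ^ 2 * Z := by
    have e : ∫ x in S, (g x - a) ^ 2 * D x ∂μ = ∫ x in S, ((g x ^ 2 * D x - (2 * a) * (g x * D x)) + a ^ 2 * D x) ∂μ :=
      integral_congr_ae (ae_of_all _ fun x => by ring)
    have i1 : Integrable (fun x => g x ^ 2 * D x - (2 * a) * (g x * D x)) (μ.restrict S) := iN.sub (im.const_mul _)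
    have i2 : Integrable (fun x => a ^ 2 * D x) (μ.restrict S) := iZ.const_mul _
    rw [e, integral_add i1 i2, integral_sub iN (im.const_mul _), integral_const_mul, integral_const_mul]
  rw [hexp, ha]
  by_cases hZ : Z = 0
  · rw [hZ]; simp
  · field_simp; ring

/-- The variance is the least mean square deviation, degenerate weight allowed: `∫_S g²D − (∫_S gD)²/∫_S D ≤ ∫_S (g − b)²D` for every constant `b` (`D ≥ 0` bounded measurable,
`g` bounded measurable, `μ` finite; if `∫_S D dμ = 0` both weighted integrals vanish). [folklore] -/
theorem variance_le_sq_dev' {g D : X → ℝ} {Cg CD : ℝ} (hg : Measurable g) (hgb : ∀ x, |g x| ≤ Cg) (hD : Measurable D) (hDb : ∀ x, |D x| ≤ CD) (hD0 : ∀ x, 0 ≤ D x) (b : ℝ) :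
    (∫ x in S, g x ^ 2 * D x ∂μ) - (∫ x in S, g x * D x ∂μ) ^ 2 / (∫ x in S, D x ∂μ) ≤ ∫ x in S, (g x - b) ^ 2 * D x ∂μ := by
  by_cases hZ : 0 < ∫ x in S, D x ∂μ
  · exact variance_le_sq_dev (μ := μ) (S := S) hD hDb hg hgb hZ b
  · have hZ0 : ∫ x in S, D x ∂μ = 0 := le_antisymm (not_lt.1 hZ) (integral_nonneg fun x => hD0 x)
    -- `∫_S g²D ≤ Cg²·∫_S D = 0`
    have iZ : Integrable D (μ.restrict S) := integrableOn_of_bdd (μ := μ) hD hDb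
    have hN : ∫ x in S, g x ^ 2 * D x ∂μ ≤ 0 := by
      calc ∫ x in S, g x ^ 2 * D x ∂μ ≤ ∫ x in S, Cg ^ 2 * D x ∂μ := by
            refine integral_mono_of_nonneg (ae_of_all _ fun x => mul_nonneg (sq_nonneg _) (hD0 x)) (iZ.const_mul _) (ae_of_all _ fun x => ?_)
            exact mul_le_mul_of_nonneg_right (by nlinarith [abs_le.1 (hgb x), sq_abs (g x)]) (hD0 x)
        _ = Cg ^ 2 * ∫ x in S, D x ∂μ := integral_const_mul _ _
        _ = 0 := by rw [hZ0, mul_zero]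
    have hdev : 0 ≤ ∫ x in S, (g x - b) ^ 2 * D x ∂μ := integral_nonneg fun x => mul_nonneg (sq_nonneg _) (hD0 x)
    rw [hZ0, div_zero, sub_zero]
    exact hN.trans hdev

/-- ★★★ **POINCARÉ TRANSPORT `ν → μ` FOR DOOR DATA `(D, J₀)`.**  `μ` finite, `ν` arbitrary, `S` measurable with `ofReal c • ν|_S ≤ μ|_S ≤ ofReal C • ν|_S` (`0 < c`, `0 ≤ C`);
`g` bounded measurable (no support condition needed); `D ≥ 0` bounded measurable; `J₀ ≥ 0` bounded jointly measurable vanishing off `S × S`; `P₀, δ ≥ 0`.  THEN the flat Poincaré inequality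
`∫_S g²D dν − (∫_S gD dν)²/∫_S D dν ≤ P₀·½∫_S∫_S (g x − g y)² J₀ dν dν + δ·∫_S g²D dν` implies
`∫_S g²D dμ − (∫_S gD dμ)²/∫_S D dμ ≤ (C/c²)P₀·½∫∫ (g x − g y)² J₀ dμ dμ + (C/c)δ·∫_S g²D dμ`
(variance = least square deviation, taken at the `ν`-mean; `∫_S h dμ ≤ C∫_S h dν` for `h ≥ 0`; the jump form and the slack go back with `c⁻²`, `c⁻¹`). [cite: Helffer2013, §7] -/
theorem poincare_transport (hc : 0 < c) (hC : 0 ≤ C) (hlo : ENNReal.ofReal c • ν.restrict S ≤ μ.restrict S) (hup : μ.restrict S ≤ ENNReal.ofReal C • ν.restrict S)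
    {g D : X → ℝ} {J₀ : X → X → ℝ} {Cg CD CJ P₀ δ : ℝ}
    (hg : Measurable g) (hgb : ∀ x, |g x| ≤ Cg) (hD : Measurable D) (hDb : ∀ x, |D x| ≤ CD) (hD0 : ∀ x, 0 ≤ D x)
    (hJ₀ : Measurable (Function.uncurry J₀)) (hJ₀b : ∀ x y, |J₀ x y| ≤ CJ) (hJ0 : ∀ x y, 0 ≤ J₀ x y) (hJS : ∀ x y, J₀ x y ≠ 0 → x ∈ S ∧ y ∈ S) (hP₀ : 0 ≤ P₀) (hδ : 0 ≤ δ)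
    (hflat : (∫ x in S, g x ^ 2 * D x ∂ν) - (∫ x in S, g x * D x ∂ν) ^ 2 / (∫ x in S, D x ∂ν) ≤
      P₀ * ((1 / 2) * ∫ x in S, ∫ y in S, (g x - g y) ^ 2 * J₀ x y ∂ν ∂ν) + δ * ∫ x in S, g x ^ 2 * D x ∂ν) :
    (∫ x in S, g x ^ 2 * D x ∂μ) - (∫ x in S, g x * D x ∂μ) ^ 2 / (∫ x in S, D x ∂μ) ≤
      (C / c ^ 2 * P₀) * ((1 / 2) * ∫ x, ∫ y, (g x - g y) ^ 2 * J₀ x y ∂μ ∂μ) + (C / c * δ) * ∫ x in S, g x ^ 2 * D x ∂μ := by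
  haveI := restrict_isFiniteMeasure_of_comparison hc hlo
  -- bounded-measurable bookkeeping
  have hsq : ∀ z, |g z ^ 2| ≤ Cg ^ 2 := fun z => by rw [abs_pow]; exact pow_le_pow_left₀ (abs_nonneg _) (hgb z) 2
  have bN : ∀ x, |g x ^ 2 * D x| ≤ Cg ^ 2 * CD := fun x => by rw [abs_mul]; exact mul_le_mul (hsq x) (hDb x) (abs_nonneg _) (sq_nonneg _)
  have bm : ∀ x, |g x * D x| ≤ Cg * CD := fun x => by rw [abs_mul]; exact mul_le_mul (hgb x) (hDb x) (abs_nonneg _) ((abs_nonneg _).trans (hgb x))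
  have mN : Measurable fun x => g x ^ 2 * D x := (hg.pow_const 2).mul hD
  have mm : Measurable fun x => g x * D x := hg.mul hD
  have iNν : Integrable (fun x => g x ^ 2 * D x) (ν.restrict S) := integrable_of_measurable_abs_le _ mN bN
  have imν : Integrable (fun x => g x * D x) (ν.restrict S) := integrable_of_measurable_abs_le _ mm bm
  have iZν : Integrable D (ν.restrict S) := integrable_of_measurable_abs_le _ hD hDb
  set a : ℝ := (∫ x in S, g x * D x ∂ν) / ∫ x in S, D x ∂ν with ha
  -- (1) variance ≤ square deviation from the FLAT mean, in `μ`
  have h1 := variance_le_sq_dev' (μ := μ) (S := S) hg hgb hD hDb hD0 a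
  -- (2) the square deviation transports upward with `C`
  have hdev_m : Measurable fun x => (g x - a) ^ 2 * D x := ((hg.sub measurable_const).pow_const 2).mul hD
  have hdev_b : ∀ x, (g x - a) ^ 2 * D x ≤ (Cg + |a|) ^ 2 * |CD| := fun x => by
    have h1' : (g x - a) ^ 2 ≤ (Cg + |a|) ^ 2 := by
      rw [← sq_abs (g x - a)]; exact pow_le_pow_left₀ (abs_nonneg _) ((abs_sub (g x) a).trans (add_le_add_left (hgb x) _)) 2
    exact mul_le_mul h1' ((le_abs_self (D x)).trans ((hDb x).trans (le_abs_self CD))) (hD0 x) (by positivity)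
  have h2 : ∫ x in S, (g x - a) ^ 2 * D x ∂μ ≤ C * ∫ x in S, (g x - a) ^ 2 * D x ∂ν :=
    setIntegral_le_of_comparison hc hC hlo hup hdev_m (fun x => mul_nonneg (sq_nonneg _) (hD0 x)) hdev_b
  -- (3) in `ν` the square deviation from the `ν`-mean is the `ν`-variance
  have h3 : ∫ x in S, (g x - a) ^ 2 * D x ∂ν = (∫ x in S, g x ^ 2 * D x ∂ν) - (∫ x in S, g x * D x ∂ν) ^ 2 / ∫ x in S, D x ∂ν := sq_dev_eq_variance iNν imν iZν
  -- (5) the slack term transports back with `c⁻¹`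
  have h5 : ∫ x in S, g x ^ 2 * D x ∂ν ≤ (1 / c) * ∫ x in S, g x ^ 2 * D x ∂μ := by
    have h := setIntegral_ge_of_comparison (S := S) hc hlo mN (fun x => mul_nonneg (sq_nonneg _) (hD0 x)) fun x => (le_abs_self _).trans (bN x)
    rw [one_div, ← div_eq_inv_mul]; exact (le_div_iff₀' hc).mpr h
  -- (6) the jump form transports back with `c⁻²`
  have hF : Measurable (Function.uncurry fun x y => (g x - g y) ^ 2 * J₀ x y) := (((hg.comp measurable_fst).sub (hg.comp measurable_snd)).pow_const 2).mul hJ₀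
  have hFb : ∀ x y, (g x - g y) ^ 2 * J₀ x y ≤ (2 * Cg) ^ 2 * |CJ| := fun x y => by
    have h1' : (g x - g y) ^ 2 ≤ (2 * Cg) ^ 2 := by
      rw [← sq_abs (g x - g y)]; exact pow_le_pow_left₀ (abs_nonneg _) ((abs_sub _ _).trans (by linarith [hgb x, hgb y])) 2
    exact mul_le_mul h1' ((le_abs_self (J₀ x y)).trans ((hJ₀b x y).trans (le_abs_self CJ))) (hJ0 x y) (by positivity)
  have h6 : ∫ x in S, ∫ y in S, (g x - g y) ^ 2 * J₀ x y ∂ν ∂ν ≤ (1 / c ^ 2) * ∫ x, ∫ y, (g x - g y) ^ 2 * J₀ x y ∂μ ∂μ :=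
    jumpForm_le_of_comparison hc hlo hF (fun x y => mul_nonneg (sq_nonneg _) (hJ0 x y)) hFb fun x y h => hJS x y (by
      intro hJ; exact h (by rw [hJ, mul_zero]))
  -- assemble
  have hJμ0 : 0 ≤ ∫ x, ∫ y, (g x - g y) ^ 2 * J₀ x y ∂μ ∂μ := integral_nonneg fun x => integral_nonneg fun y => mul_nonneg (sq_nonneg _) (hJ0 x y)
  have hNμ0 : 0 ≤ ∫ x in S, g x ^ 2 * D x ∂μ := integral_nonneg fun x => mul_nonneg (sq_nonneg _) (hD0 x)
  calc (∫ x in S, g x ^ 2 * D x ∂μ) - (∫ x in S, g x * D x ∂μ) ^ 2 / (∫ x in S, D x ∂μ)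
      ≤ ∫ x in S, (g x - a) ^ 2 * D x ∂μ := h1
    _ ≤ C * ∫ x in S, (g x - a) ^ 2 * D x ∂ν := h2
    _ = C * ((∫ x in S, g x ^ 2 * D x ∂ν) - (∫ x in S, g x * D x ∂ν) ^ 2 / ∫ x in S, D x ∂ν) := by rw [h3]
    _ ≤ C * (P₀ * ((1 / 2) * ∫ x in S, ∫ y in S, (g x - g y) ^ 2 * J₀ x y ∂ν ∂ν) + δ * ∫ x in S, g x ^ 2 * D x ∂ν) := mul_le_mul_of_nonneg_left hflat hC
    _ ≤ C * (P₀ * ((1 / 2) * ((1 / c ^ 2) * ∫ x, ∫ y, (g x - g y) ^ 2 * J₀ x y ∂μ ∂μ)) + δ * ((1 / c) * ∫ x in S, g x ^ 2 * D x ∂μ)) := by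
        gcongr
    _ = (C / c ^ 2 * P₀) * ((1 / 2) * ∫ x, ∫ y, (g x - g y) ^ 2 * J₀ x y ∂μ ∂μ) + (C / c * δ) * ∫ x in S, g x ^ 2 * D x ∂μ := by ring

end Transport

end Summit.QuantumFields.YangMills.Theorems.FemtoTransferGap.StiffDoor

/-! ## §2 At the central fibre: `ν = balLebesgue L`, `S = cS L β`, constants from the SHARP density -/

namespace Summit.QuantumFields.YangMills.Theorems.FemtoTransferGap.TwoLattice.ConstTube

open Summit.QuantumFields.YangMills.Theorems.FemtoTransferGap
open Literature.MathematicalPhysics.QuantumFieldTheory Literature.MathematicalPhysics.QuantumLattice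

variable (L : ℕ) [NeZero L]

/-- ★★★ **(B3) ⇒ the `hflat` clause of `spec_gap_inputs` from a FLAT Poincaré inequality.**  There is `ρ₀ > 0` (`L`-dependent, `β`-free) such that for every `ε ∈ (0,1)`, for all large `β`:
whenever door data `D ≥ 0`, `J₀ ≥ 0` (bounded measurable, `J₀` vanishing off `cS β × cS β`) and a bounded measurable `g` satisfy the Poincaré inequality against
`balLebesgue L` with constants `(P₀, δ)`, they satisfy it against `orthoTransverse L` with the `β`-FREE constants `(((1+ε)/((1−ε)²ρ₀))·P₀, ((1+ε)/(1−ε))·δ)`. [cite: Luscher1983, §3] -/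
theorem hflat_transport_cS :
    ∃ ρ₀ : ℝ, 0 < ρ₀ ∧ ∀ ε : ℝ, 0 < ε → ε < 1 → ∀ᶠ β : ℝ in atTop,
      ∀ (g D : (Edge 3 L → Fin 3 → ℝ) → ℝ) (J₀ : (Edge 3 L → Fin 3 → ℝ) → (Edge 3 L → Fin 3 → ℝ) → ℝ) (Cg CD CJ P₀ δ : ℝ),
        Measurable g → (∀ x, |g x| ≤ Cg) → Measurable D → (∀ x, |D x| ≤ CD) → (∀ x, 0 ≤ D x) →
        Measurable (Function.uncurry J₀) → (∀ x y, |J₀ x y| ≤ CJ) → (∀ x y, 0 ≤ J₀ x y) → (∀ x y, J₀ x y ≠ 0 → x ∈ cS L β ∧ y ∈ cS L β) → 0 ≤ P₀ → 0 ≤ δ →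
        (∫ x in cS L β, g x ^ 2 * D x ∂balLebesgue L) - (∫ x in cS L β, g x * D x ∂balLebesgue L) ^ 2 / (∫ x in cS L β, D x ∂balLebesgue L) ≤
            P₀ * ((1 / 2) * ∫ x in cS L β, ∫ y in cS L β, (g x - g y) ^ 2 * J₀ x y ∂balLebesgue L ∂balLebesgue L) + δ * ∫ x in cS L β, g x ^ 2 * D x ∂balLebesgue L →
        (∫ x in cS L β, g x ^ 2 * D x ∂orthoTransverse L) - (∫ x in cS L β, g x * D x ∂orthoTransverse L) ^ 2 / (∫ x in cS L β, D x ∂orthoTransverse L) ≤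
            ((1 + ε) / ((1 - ε) ^ 2 * ρ₀) * P₀) * ((1 / 2) * ∫ x, ∫ y, (g x - g y) ^ 2 * J₀ x y ∂orthoTransverse L ∂orthoTransverse L) +
              ((1 + ε) / (1 - ε) * δ) * ∫ x in cS L β, g x ^ 2 * D x ∂orthoTransverse L := by
  obtain ⟨ρ₀, hρ₀, h⟩ := orthoTransverse_restrict_cS_sharp L
  refine ⟨ρ₀, hρ₀, fun ε hε hε1 => ?_⟩
  haveI := isFiniteMeasure_orthoTransverse L
  filter_upwards [h ε hε] with β ⟨hlo, hup⟩ g D J₀ Cg CD CJ P₀ δ hg hgb hD hDb hD0 hJ₀ hJ₀b hJ0 hJS hP₀ hδ hflat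
  have hc : 0 < (1 - ε) * ρ₀ := mul_pos (by linarith) hρ₀
  have hC : 0 ≤ (1 + ε) * ρ₀ := by positivity
  have ht := StiffDoor.poincare_transport (μ := orthoTransverse L) (ν := balLebesgue L) hc hC hlo hup hg hgb hD hDb hD0 hJ₀ hJ₀b hJ0 hJS hP₀ hδ hflat
  have e1 : (1 + ε) * ρ₀ / ((1 - ε) * ρ₀) ^ 2 * P₀ = (1 + ε) / ((1 - ε) ^ 2 * ρ₀) * P₀ := by
    field_simp
  have e2 : (1 + ε) * ρ₀ / ((1 - ε) * ρ₀) * δ = (1 + ε) / (1 - ε) * δ := by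
    field_simp
  rw [e1, e2] at ht
  exact ht

/-! ## §3 The same for ANY flat parametrisation `T` of the balanced subspace (`ν = μ.map T`), and the pull-back of the flat inequality to `V` -/

section Param

variable {V : Type*} [NormedAddCommGroup V] [NormedSpace ℝ V] [FiniteDimensional ℝ V] [MeasurableSpace V] [BorelSpace V]
  (μ : Measure V) [μ.IsAddHaarMeasure] {T : V →ₗ[ℝ] (Edge 3 L → Fin 3 → ℝ)}

/-- ★★ **MEASURE FORM on the support for `ν = μ.map T`** (`T` injective linear with range the balanced subspace, `μ` any additive Haar measure on `V`): there is `ρ_T > 0` with, for every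
`ε > 0` and all large `β`, `(1−ε)ρ_T·(μ.map T)|_{cS β} ≤ π|_{cS β} ≤ (1+ε)ρ_T·(μ.map T)|_{cS β}`. [folklore] -/
theorem orthoTransverse_restrict_cS_sharp_map (hT : Function.Injective T) (hrange : Set.range T = balancedSet L) :
    ∃ ρ₀ : ℝ, 0 < ρ₀ ∧ ∀ ε : ℝ, 0 < ε → ∀ᶠ β : ℝ in atTop,
      ENNReal.ofReal ((1 - ε) * ρ₀) • (μ.map T).restrict (cS L β) ≤ (orthoTransverse L).restrict (cS L β) ∧
      (orthoTransverse L).restrict (cS L β) ≤ ENNReal.ofReal ((1 + ε) * ρ₀) • (μ.map T).restrict (cS L β) := by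
  obtain ⟨κ, hκ, hν⟩ := balLebesgue_eq_smul_map L μ hT hrange
  obtain ⟨ρ₀, hρ₀, h⟩ := orthoTransverse_restrict_cS_sharp L
  refine ⟨κ * ρ₀, by positivity, fun ε hε => ?_⟩
  have hk : ∀ t : ℝ, ENNReal.ofReal (t * ρ₀) * (κ : ℝ≥0∞) = ENNReal.ofReal (t * (κ * ρ₀)) := fun t => by
    rw [ENNReal.ofReal, ENNReal.ofReal, ← ENNReal.coe_mul, ENNReal.coe_inj]
    by_cases ht : 0 ≤ t * ρ₀
    · rw [show t * (κ * ρ₀) = (t * ρ₀) * κ by ring, Real.toNNReal_mul ht, Real.toNNReal_coe]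
    · have ht' : t * ρ₀ ≤ 0 := le_of_not_ge ht
      have ht'' : t * (κ * ρ₀) ≤ 0 := by
        rw [show t * (κ * ρ₀) = (t * ρ₀) * κ by ring]; exact mul_nonpos_of_nonpos_of_nonneg ht' κ.2
      rw [Real.toNNReal_of_nonpos ht', Real.toNNReal_of_nonpos ht'', zero_mul]
  filter_upwards [h ε hε] with β ⟨hlo, hup⟩
  rw [hν, Measure.restrict_smul, smul_smul, hk] at hlo hup
  exact ⟨hlo, hup⟩

/-- ★★★ **(B3) ⇒ `hflat` for ANY flat parametrisation**: as `hflat_transport_cS`, with `balLebesgue L` replaced by `μ.map T` (`T` injective linear, range the balanced subspace, `μ` additive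
Haar on `V`): factors `(1+ε)/((1−ε)²ρ_T)` on `P₀` and `(1+ε)/(1−ε)` on `δ`, `β`-free. [cite: Luscher1983, §3] -/
theorem hflat_transport_cS_map (hT : Function.Injective T) (hrange : Set.range T = balancedSet L) :
    ∃ ρ₀ : ℝ, 0 < ρ₀ ∧ ∀ ε : ℝ, 0 < ε → ε < 1 → ∀ᶠ β : ℝ in atTop,
      ∀ (g D : (Edge 3 L → Fin 3 → ℝ) → ℝ) (J₀ : (Edge 3 L → Fin 3 → ℝ) → (Edge 3 L → Fin 3 → ℝ) → ℝ) (Cg CD CJ P₀ δ : ℝ),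
        Measurable g → (∀ x, |g x| ≤ Cg) → Measurable D → (∀ x, |D x| ≤ CD) → (∀ x, 0 ≤ D x) →
        Measurable (Function.uncurry J₀) → (∀ x y, |J₀ x y| ≤ CJ) → (∀ x y, 0 ≤ J₀ x y) → (∀ x y, J₀ x y ≠ 0 → x ∈ cS L β ∧ y ∈ cS L β) → 0 ≤ P₀ → 0 ≤ δ →
        (∫ x in cS L β, g x ^ 2 * D x ∂μ.map T) - (∫ x in cS L β, g x * D x ∂μ.map T) ^ 2 / (∫ x in cS L β, D x ∂μ.map T) ≤
            P₀ * ((1 / 2) * ∫ x in cS L β, ∫ y in cS L β, (g x - g y) ^ 2 * J₀ x y ∂μ.map T ∂μ.map T) + δ * ∫ x in cS L β, g x ^ 2 * D x ∂μ.map T →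
        (∫ x in cS L β, g x ^ 2 * D x ∂orthoTransverse L) - (∫ x in cS L β, g x * D x ∂orthoTransverse L) ^ 2 / (∫ x in cS L β, D x ∂orthoTransverse L) ≤
            ((1 + ε) / ((1 - ε) ^ 2 * ρ₀) * P₀) * ((1 / 2) * ∫ x, ∫ y, (g x - g y) ^ 2 * J₀ x y ∂orthoTransverse L ∂orthoTransverse L) +
              ((1 + ε) / (1 - ε) * δ) * ∫ x in cS L β, g x ^ 2 * D x ∂orthoTransverse L := by
  obtain ⟨ρ₀, hρ₀, h⟩ := orthoTransverse_restrict_cS_sharp_map L μ hT hrange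
  refine ⟨ρ₀, hρ₀, fun ε hε hε1 => ?_⟩
  haveI := isFiniteMeasure_orthoTransverse L
  filter_upwards [h ε hε] with β ⟨hlo, hup⟩ g D J₀ Cg CD CJ P₀ δ hg hgb hD hDb hD0 hJ₀ hJ₀b hJ0 hJS hP₀ hδ hflat
  have hc : 0 < (1 - ε) * ρ₀ := mul_pos (by linarith) hρ₀
  have hC : 0 ≤ (1 + ε) * ρ₀ := by positivity
  have ht := StiffDoor.poincare_transport (μ := orthoTransverse L) (ν := μ.map T) hc hC hlo hup hg hgb hD hDb hD0 hJ₀ hJ₀b hJ0 hJS hP₀ hδ hflat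
  have e1 : (1 + ε) * ρ₀ / ((1 - ε) * ρ₀) ^ 2 * P₀ = (1 + ε) / ((1 - ε) ^ 2 * ρ₀) * P₀ := by
    field_simp
  have e2 : (1 + ε) * ρ₀ / ((1 - ε) * ρ₀) * δ = (1 + ε) / (1 - ε) * δ := by
    field_simp
  rw [e1, e2] at ht
  exact ht

omit [NeZero L] [NormedAddCommGroup V] [NormedSpace ℝ V] [FiniteDimensional ℝ V] [BorelSpace V] [μ.IsAddHaarMeasure] in
/-- ★ **The flat side lives on `V`**: for a measurable embedding `T` (e.g. an injective linear map of finite-dimensional spaces), the Poincaré inequality with door data for the measure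
`μ.map T` on `S` is LITERALLY the one on `V` for the pulled-back data `g ∘ T`, `D ∘ T`, `J₀ ∘ (T × T)` on `T ⁻¹' S` against `μ` (change of variables, all five integrals). [folklore] -/
theorem hflat_map_of_pullback {T : V → (Edge 3 L → Fin 3 → ℝ)} (hT : MeasurableEmbedding T) {S : Set (Edge 3 L → Fin 3 → ℝ)}
    {g D : (Edge 3 L → Fin 3 → ℝ) → ℝ} {J₀ : (Edge 3 L → Fin 3 → ℝ) → (Edge 3 L → Fin 3 → ℝ) → ℝ} {P₀ δ : ℝ}
    (h : (∫ v in T ⁻¹' S, g (T v) ^ 2 * D (T v) ∂μ) - (∫ v in T ⁻¹' S, g (T v) * D (T v) ∂μ) ^ 2 / (∫ v in T ⁻¹' S, D (T v) ∂μ) ≤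
      P₀ * ((1 / 2) * ∫ v in T ⁻¹' S, ∫ w in T ⁻¹' S, (g (T v) - g (T w)) ^ 2 * J₀ (T v) (T w) ∂μ ∂μ) + δ * ∫ v in T ⁻¹' S, g (T v) ^ 2 * D (T v) ∂μ) :
    (∫ x in S, g x ^ 2 * D x ∂μ.map T) - (∫ x in S, g x * D x ∂μ.map T) ^ 2 / (∫ x in S, D x ∂μ.map T) ≤
      P₀ * ((1 / 2) * ∫ x in S, ∫ y in S, (g x - g y) ^ 2 * J₀ x y ∂μ.map T ∂μ.map T) + δ * ∫ x in S, g x ^ 2 * D x ∂μ.map T := by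
  rw [hT.setIntegral_map, hT.setIntegral_map, hT.setIntegral_map, hT.setIntegral_map]
  have e : (fun v => ∫ y in S, (g (T v) - g y) ^ 2 * J₀ (T v) y ∂μ.map T) = fun v => ∫ w in T ⁻¹' S, (g (T v) - g (T w)) ^ 2 * J₀ (T v) (T w) ∂μ :=
    funext fun v => hT.setIntegral_map _ _
  rw [e]
  exact h

omit [μ.IsAddHaarMeasure] in
/-- An injective linear map of finite-dimensional spaces is a measurable embedding (closed embedding). [folklore] -/
theorem measurableEmbedding_of_injective_linear (hT : Function.Injective T) : MeasurableEmbedding (T : V → Edge 3 L → Fin 3 → ℝ) :=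
  (LinearMap.isClosedEmbedding_of_injective (f := T) (LinearMap.ker_eq_bot.2 hT)).measurableEmbedding

end Param

end Summit.QuantumFields.YangMills.Theorems.FemtoTransferGap.TwoLattice.ConstTube

end
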